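import Summits.ABC.IUTFork.Cor312SettingPrVolM
import Summits.ABC.IUTFork.Cor312FrameVolumePiecesDH
import Summits.ABC.IUTFork.Cor312StatementHullSetLocality
import Summits.ABC.IUTFork.Cor312ProvenanceFrames
import HarnessLib

/-!
# [IUTchIII] Corollary 3.12, statement — container-robustness WITH PROVENANCE at the M-LEVEL real log-shells `K_{v̲}`:
# the field-box setting over abc-iut-w5-d166's frame pieces vs the summandwise setting `Real.settingPrVolM`

Record-only file (D-0012) of the abc-iut cell (seat abc-iut-w4-d013, gen 6; branch C «abc ⇐ S», C-lead ruling C-R12 (e)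
«target #2′: the M-level (V̲, K_{v̲}) real volume setting»; unit P3b of the G1-Θ port, glue between its two routes).
TAKES NO SIDE on [IUTchIII] Cor. 3.12.

At the M level (carriers `K_{v̲}`, `v̲ ∈ V̲ ≅ V_mod`, [IUTchI] Def. 3.1 (e), kurims `paper:url-690e7b3c6199` p. 62; index
skeleton abc-iut-c312-5 `Real.thetaIndexOfInitial D`) the crew's real volume stack now exists in its TWO readings of the
mono-analytic container `𝕄(−)` of [IUTchIII] Rmk. 3.1.1 (ii)(iii) (kurims `paper:url-4b091feeb646` pp. 94–96), exactly as at
the F level: the FIELD-BOX reading — abc-iut-w5-d166 `Real.frameVolumePiecesOfInitialDH D hlog` (`Cor312FrameVolumePiecesM`,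
p434705), consumed by abc-iut-c312-6's `settingOfFrameVolumes` and by abc-iut-c312-8's M-level PROVENANCE
`Cor312Prov.isSettingOf_ofFrames` / `isSettingOf_settingOfFrameVolumes` (`Cor312ProvenanceFrames`, typed over
`thetaIndexOfInitial D`) —, and the SUMMANDWISE reading — this seat's `Real.summandPiecesPrM` / `Real.settingPrVolM`
(`Cor312SettingPrVolM`, abc-iut-c312-7's `Setting.ofComparison` route, the route of c312-7's `settingPrVolSharp` that
branch C's READ binder `hΘ` names and that units P4/P5 of the port twin). THIS FILE is the M-level twin of abc-iut-c312-6's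
`Cor312FrameVolumePiecesPr` §2–§4 (p42xxxx):

* §1 AGREEMENT ON HULL-SETS at every place of `ℚ`: `logvol_frameVolumePiecesOfInitialDH_preimage_hullSet` — field-box
  log-volume = summandwise verbatim container on `e⁻¹(λ·𝒪_L)`, `λ_s ≠ 0` (finite place: c312-6's generic
  `PadicPresentation.sum_frameWeight_mul_mulLogvol` AT `presAtM D hlog u`; `∞`: both sides `0`);
* §2 the twin `Real.situationPrFramesM` / **`Real.settingPrFramesM`** (c312-7 `Setting.ofFrames` over the frame pieces'
  `toRealFrames thetaBox qCentre`, `hadm` DISCHARGED by c312-6 `hadm_of_realizes`; binders EXACTLY those of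
  `Real.settingPrVolM`, `hfin` transported by `qSupport_framesPrM_eq`), which IS c312-6's `settingOfFrameVolumes`
  (`settingPrFramesM_eq_settingOfFrameVolumes`, `rfl`), and by c312-6's GENERIC hull-set locality
  (`Cor312.HullSetLocality.*`, p427194) in three lines each: same `qLocal` / `thetaLocal` / `negLogTheta` / `negLogQ` and
  **`statement_settingPrFramesM_iff : (settingPrFramesM …).Statement ↔ (settingPrVolM …).Statement`**;
* §3 **PROVENANCE TRANSFERS**: `isSettingOf_settingPrFramesM_iff` — `IsSettingOf D (settingPrFramesM …) ↔
  IsSettingOf D (settingPrVolM …)` (the index clauses concern the common `thetaIndexOfInitial D`, the `q`-number clause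
  transfers by `negLogQ_settingPrFramesM`), the conjunction transfer, and **`isSettingOf_settingPrVolM_of_frames`**:
  c312-8's `isSettingOf_settingOfFrameVolumes` (modulo its printed clauses (hmarg)/(hbad)/(hgood) on the free binders
  weights / `q`-centre) read at the SUMMANDWISE setting — so the `q`-side of branch C's per-datum certificate needs no second
  provenance file on the summandwise route.
[claim: Mochizuki2012, status: disputed] for the quoted setting and container; [cite: Mochizuki2012, IUTchI Def. 3.1 (e) p. 62];
[cite: DupuyHilado2025, §3.6, Def. 3.6.1]; [cite: MochizukiAbsTopIII2015, Prop. 5.7 (i)(b) p. 138]. Everything proved is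
bookkeeping over OUR typed objects. HONEST FRAMING: no edit to c312-6's / c312-7's / c312-8's or the lead's files; nothing
here bears on the truth of [IUTchIII] Cor. 3.12; typed ≠ proved; instantiated ≠ endorsed. Deliberately NOT here: Θ-boxes /
`q`-centre / ideles (binders; units P4/P4a), `ThetaFinite` (P5), the comparison with abc-iut-S2's number (P6), any judgement.
-/

noncomputable section

open Set Function NumberField IsDedekindDomain

namespace Summit.ABC.IUTFork.Thm311.Real

open Cor312 Cor312Vol Cor312Prov Literature.IUT.LogThetaLattice Literature.IUT.LogVolume Literature.IUT.HodgeTheaters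
  Literature.NumberTheory.NumberFields

variable {F K Fbar : Type} [Field F] [NumberField F] [Field K] [NumberField K] [Algebra F K]
  [Field Fbar] [Algebra F Fbar] [Algebra K Fbar] {E : WeierstrassCurve F} [E.IsElliptic] {l : ℕ}
  {Pb : BadPlacePredicates K} (D : InitialThetaData F K Fbar E l Pb) {logvK : PadicLogsVal K}
  (hlog : LogvAnalyticVal logvK)

/-! ## §1. Agreement of the field-box pieces with the summandwise container on hull-sets -/

section Agreement

variable (M : Type) [Field M] [NumberField M]
  (archPk : ∀ (j : (thetaIndexOfInitial D).Label) (vQ : (thetaIndexOfInitial D).VQ),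
    Set ((logShellsOfInitialDH D logvK).Packet j vQ))
  (archSub : ∀ (j : (thetaIndexOfInitial D).Label) (v : (thetaIndexOfInitial D).V),
    Set ((logShellsOfInitialDH D logvK).Packet j ((thetaIndexOfInitial D).over v)))
  (Ψ : ℤ → ∀ v : (thetaIndexOfInitial D).V, v ∈ (thetaIndexOfInitial D).Vbad →
    Set ((logShellsOfInitialDH D logvK).StarPacket v))
  (act : ℤ → ∀ v : (thetaIndexOfInitial D).V, v ∈ (thetaIndexOfInitial D).Vbad →
    (logShellsOfInitialDH D logvK).StarPacket v → Module.End ℚ ((logShellsOfInitialDH D logvK).StarPacket v))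
  (Mmod : ℤ → ∀ j : (thetaIndexOfInitial D).LabelStar, Set ((logShellsOfInitialDH D logvK).GlobalPacket j.1))
  (region : ℤ → ∀ j : (thetaIndexOfInitial D).LabelStar, FinDivisor M → ∀ vQ : (thetaIndexOfInitial D).VQ,
    Set ((logShellsOfInitialDH D logvK).Packet j.1 vQ))
  (n : ℤ)

/-- **Field-box log-volume (M-level frame pieces) = the summandwise packet-normalised verbatim container on hull-set
preimages, at EVERY place of `ℚ`** (for `λ_s ≠ 0`): at a finite place c312-6's generic `sum_frameWeight_mul_mulLogvol` at
`presAtM D hlog u`; at `∞` both sides are `0` (empty factor index / zero summand weights of the trivial container).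
[claim: Mochizuki2012, status: disputed] [cite: MochizukiAbsTopIII2015, Prop. 5.7 (i)(b) p. 138] -/
theorem logvol_frameVolumePiecesOfInitialDH_preimage_hullSet :
    ∀ (j : (thetaIndexOfInitial D).Label) (vQ : (thetaIndexOfInitial D).VQ)
    (c : ∀ s : factorIdxM D hlog j vQ, factorFieldM D hlog j vQ s), (∀ s, c s ≠ 0) →
    (frameVolumePiecesOfInitialDH D hlog).logvol j vQ
        (factorMapM D hlog j vQ ⁻¹' hullSet (factorFieldM D hlog j vQ) c) =
      ((situationPrVolM D hlog M archPk archSub Ψ act Mmod region).D n).logvol j vQ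
        (factorMapM D hlog j vQ ⁻¹' hullSet (factorFieldM D hlog j vQ) c)
  | j, .inl u, c, _ => by
    have h1 : (frameVolumePiecesOfInitialDH D hlog).logvol j (.inl u)
        (factorMapM D hlog j (.inl u) ⁻¹' hullSet (factorFieldM D hlog j (.inl u)) c) = 0 := by
      unfold FrameVolumePieces.logvol
      exact Finset.sum_eq_zero fun s _ => s.elim
    have h2 : ((situationPrVolM D hlog M archPk archSub Ψ act Mmod region).D n).logvol j (.inl u)
        (factorMapM D hlog j (.inl u) ⁻¹' hullSet (factorFieldM D hlog j (.inl u)) c) = 0 := by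
      show (summandPiecesPrM D hlog).logvol j (.inl u) _ = 0
      unfold SummandPieces.logvol
      exact Finset.sum_eq_zero fun e _ => by
        show (0 : ℝ) * _ = 0
        exact zero_mul _
    rw [h1, h2]
  | j, .inr u, c, hc => by
    letI hCF : Fintype ((thetaIndexOfInitial D).Caps j → (thetaIndexOfInitial D).Fibre (Val.non u)) :=
      Fintype.ofFinite _
    rw [show factorMapM D hlog j (.inr u) ⁻¹' hullSet (factorFieldM D hlog j (.inr u)) c =
        (frameVolumePiecesOfInitialDH D hlog).e j (.inr u) ⁻¹'
          hullSet ((frameVolumePiecesOfInitialDH D hlog).K j (.inr u)) c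
        from rfl, (frameVolumePiecesOfInitialDH D hlog).logvol_preimage_hullSet j (.inr u) c]
    show (∑ s : (presAtM D hlog u).factorIdx j, (presAtM D hlog u).frameWeight j s *
        ((presAtM D hlog u).factorVolume j s).mulLogvol (c s)) =
      ((situationPrVolM D hlog M archPk archSub Ψ act Mmod region).D n).logvol j (.inr u)
        (factorMapM D hlog j (.inr u) ⁻¹' hullSet (factorFieldM D hlog j (.inr u)) c)
    exact (presAtM D hlog u).sum_frameWeight_mul_mulLogvol j c hc

/-- The same for an arbitrary hull-set `H = λ·𝒪_L`. [claim: Mochizuki2012, status: disputed] -/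
theorem logvol_frameVolumePiecesOfInitialDH_preimage_of_isHullSet (j : (thetaIndexOfInitial D).Label)
    (vQ : (thetaIndexOfInitial D).VQ) {H : Set (∀ s : factorIdxM D hlog j vQ, factorFieldM D hlog j vQ s)}
    (hH : IsHullSet (factorFieldM D hlog j vQ) H) :
    (frameVolumePiecesOfInitialDH D hlog).logvol j vQ (factorMapM D hlog j vQ ⁻¹' H) =
      ((situationPrVolM D hlog M archPk archSub Ψ act Mmod region).D n).logvol j vQ (factorMapM D hlog j vQ ⁻¹' H) := by
  obtain ⟨c, hc, rfl⟩ := hH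
  exact logvol_frameVolumePiecesOfInitialDH_preimage_hullSet D hlog M archPk archSub Ψ act Mmod region n j vQ c hc

/-! ## §2. The field-box twin `settingPrFramesM` and container-robustness (via hull-set locality) -/

/-- The situation of Thm. 3.11 over the M-level real log-shells with the FIELD-BOX volumes of abc-iut-w5-d166's frame
pieces (twin of c312-6's `situationPrFrames`). [claim: Mochizuki2012, status: disputed] -/
abbrev situationPrFramesM : Situation (thetaIndexOfInitial D) :=
  Situation.ofShells (logShellsOfInitialDH D logvK) M archPk archSub (frameVolumePiecesOfInitialDH D hlog).Adm
    (frameVolumePiecesOfInitialDH D hlog).logvol Ψ act Mmod region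

/-- Every line of `situationPrFramesM` carries the pieces' volumes (by `rfl`). [folklore] -/
theorem realizes_situationPrFramesM :
    (frameVolumePiecesOfInitialDH D hlog).Realizes
      ((situationPrFramesM D hlog M archPk archSub Ψ act Mmod region).D n) :=
  ⟨fun _ _ _ => Iff.rfl, fun _ _ _ => rfl⟩

variable {HT : Type} {LogLink : HT → HT → Type} {IsFull : ∀ {s t : HT}, LogLink s t → Prop}
  (lat : LGPGaussianLogThetaLattice LogLink IsFull)
  {Frd : Type} {IsoF : Frd → Frd → Type} {Ob : Frd → Type} {realify : Frd → Frd} {Strip : Type}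
  {IsoS : Strip → Strip → Type}
  {Mv : ∀ v : (thetaIndexOfInitial D).V, v ∈ (thetaIndexOfInitial D).Vbad → Type} [∀ v h, Monoid (Mv v h)]
  (sig : GlobalLGPFrobenioidSignature (thetaIndexOfInitial D).lstar (thetaIndexOfInitial D).V
    (· ∈ (thetaIndexOfInitial D).Vbad) Frd IsoF Ob realify Strip IsoS Mv)
  (split : SplittingMonoids Mv) {ObΔ : Type}
  {N : ∀ v : (thetaIndexOfInitial D).V, v ∈ (thetaIndexOfInitial D).Vbad → Type} [∀ v h, Monoid (N v h)]
  (qData : QPilotData ObΔ N)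
  (thetaBox : ℤ → Ob sig.Clgp → ∀ (j : (thetaIndexOfInitial D).Label) (vQ : (thetaIndexOfInitial D).VQ),
    Set (∀ s : factorIdxM D hlog j vQ, factorFieldM D hlog j vQ s))
  (qCentre : ObΔ → ∀ (j : (thetaIndexOfInitial D).Label) (vQ : (thetaIndexOfInitial D).VQ),
    ∀ s : factorIdxM D hlog j vQ, factorFieldM D hlog j vQ s)
  (hq : ∀ j vQ s, qCentre (qPilotObject qData) j vQ s ≠ 0)
  (hfin : ∀ j : (thetaIndexOfInitial D).Label, (Function.support fun vQ =>
    ((situationPrVolM D hlog M archPk archSub Ψ act Mmod region).D n).logvol j vQ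
      (factorMapM D hlog j vQ ⁻¹' hullSet (factorFieldM D hlog j vQ) (qCentre (qPilotObject qData) j vQ))).Finite)

include hq in
/-- The `q`-supports agree, so `Real.settingPrVolM`'s binder `hfin` serves both containers. [folklore] -/
theorem qSupport_framesPrM_eq (j : (thetaIndexOfInitial D).Label) :
    (Function.support fun vQ => ((situationPrFramesM D hlog M archPk archSub Ψ act Mmod region).D n).logvol j vQ
      (factorMapM D hlog j vQ ⁻¹' hullSet (factorFieldM D hlog j vQ) (qCentre (qPilotObject qData) j vQ))) =
    (Function.support fun vQ => ((situationPrVolM D hlog M archPk archSub Ψ act Mmod region).D n).logvol j vQ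
      (factorMapM D hlog j vQ ⁻¹' hullSet (factorFieldM D hlog j vQ) (qCentre (qPilotObject qData) j vQ))) := by
  ext vQ
  simp only [Function.mem_support, ne_eq]
  rw [show ((situationPrFramesM D hlog M archPk archSub Ψ act Mmod region).D n).logvol j vQ
      (factorMapM D hlog j vQ ⁻¹' hullSet (factorFieldM D hlog j vQ) (qCentre (qPilotObject qData) j vQ)) =
      (frameVolumePiecesOfInitialDH D hlog).logvol j vQ
        (factorMapM D hlog j vQ ⁻¹' hullSet (factorFieldM D hlog j vQ) (qCentre (qPilotObject qData) j vQ)) from rfl,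
    logvol_frameVolumePiecesOfInitialDH_preimage_hullSet D hlog M archPk archSub Ψ act Mmod region n j vQ _ (hq j vQ)]

/-- **The setting of [IUTchIII] Cor. 3.12 over the M-level real log-shells with the FIELD-BOX volumes** — c312-7's
`Setting.ofFrames` over the frame pieces' `toRealFrames thetaBox qCentre` (`hadm` DISCHARGED by c312-6's
`hadm_of_realizes`), binders EXACTLY those of `Real.settingPrVolM` (`hfin` transported) — the twin of c312-6's
`settingPrFrames`. [claim: Mochizuki2012, status: disputed] -/
def settingPrFramesM : Cor312.Setting (situationPrFramesM D hlog M archPk archSub Ψ act Mmod region) :=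
  Setting.ofFrames n lat sig split qData
    (FrameVolumePieces.toRealFrames (S := situationPrFramesM D hlog M archPk archSub Ψ act Mmod region)
      (frameVolumePiecesOfInitialDH D hlog) thetaBox qCentre) hq
    (FrameVolumePieces.hadm_of_realizes (S := situationPrFramesM D hlog M archPk archSub Ψ act Mmod region)
      (V := frameVolumePiecesOfInitialDH D hlog)
      (realizes_situationPrFramesM D hlog M archPk archSub Ψ act Mmod region n))
    (fun j => (qSupport_framesPrM_eq D hlog M archPk archSub Ψ act Mmod region n qData qCentre hq j).symm ▸ hfin j)

/-- `settingPrFramesM` IS c312-6's packaged `settingOfFrameVolumes` at the M-level frame pieces (definitional) — so every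
theorem of c312-6 / c312-8 about `settingOfFrameVolumes` over `thetaIndexOfInitial D` (closed-form `qLocal_ofFrames`,
`thetaLocal_ofFrames_of_hull_eq`, the provenance `Cor312Prov.isSettingOf_settingOfFrameVolumes`) is a theorem about
`settingPrFramesM`. [folklore] -/
theorem settingPrFramesM_eq_settingOfFrameVolumes :
    settingPrFramesM D hlog M archPk archSub Ψ act Mmod region n lat sig split qData thetaBox qCentre hq hfin =
      FrameVolumePieces.settingOfFrameVolumes (S := situationPrFramesM D hlog M archPk archSub Ψ act Mmod region)
        (V := frameVolumePiecesOfInitialDH D hlog) lat sig split qData thetaBox qCentre hq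
        (fun j => (qSupport_framesPrM_eq D hlog M archPk archSub Ψ act Mmod region n qData qCentre hq j).symm ▸ hfin j)
        (realizes_situationPrFramesM D hlog M archPk archSub Ψ act Mmod region n) :=
  rfl

/-- The column of `settingPrFramesM` is `n`. [folklore] -/
theorem settingPrFramesM_n :
    (settingPrFramesM D hlog M archPk archSub Ψ act Mmod region n lat sig split qData thetaBox qCentre hq hfin).n = n :=
  rfl

/-- The two log-volumes agree on every hull-set of every frame of `settingPrFramesM` (the frames are c312-7's real
frames pulled back along `factorMapM`; §1). [folklore] -/
theorem logvol_agree_on_hul_settingPrFramesM (j : (thetaIndexOfInitial D).Label) (vQ : (thetaIndexOfInitial D).VQ) :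
    ∀ H ∈ ((settingPrFramesM D hlog M archPk archSub Ψ act Mmod region n lat sig split qData thetaBox qCentre hq
      hfin).frame j vQ).Hul,
      (frameVolumePiecesOfInitialDH D hlog).logvol j vQ H = (summandPiecesPrM D hlog).logvol j vQ H := by
  rintro _ ⟨H', hH', rfl⟩
  exact logvol_frameVolumePiecesOfInitialDH_preimage_of_isHullSet D hlog M archPk archSub Ψ act Mmod region n j vQ hH'

/-- Same hull frames as `Real.settingPrVolM` (c312-7 `HullFrame.ofComparison = (ofLocalFields _).comap _`). [folklore] -/
theorem frame_settingPrFramesM : ∀ (j : (thetaIndexOfInitial D).Label) (vQ : (thetaIndexOfInitial D).VQ),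
    (settingPrFramesM D hlog M archPk archSub Ψ act Mmod region n lat sig split qData thetaBox qCentre hq hfin).frame
        j vQ =
      (settingPrVolM D hlog M archPk archSub Ψ act Mmod region n lat sig split qData thetaBox qCentre hq hfin).frame
        j vQ :=
  fun _ _ => rfl

/-- Same (Ind3)-enlarged Θ-regions as `Real.settingPrVolM` (same Θ-boxes, same comparison). [folklore] -/
theorem thetaRegion3_settingPrFramesM : ∀ (j : (thetaIndexOfInitial D).Label) (vQ : (thetaIndexOfInitial D).VQ),
    (settingPrFramesM D hlog M archPk archSub Ψ act Mmod region n lat sig split qData thetaBox qCentre hq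
        hfin).thetaRegion3 j vQ =
      (settingPrVolM D hlog M archPk archSub Ψ act Mmod region n lat sig split qData thetaBox qCentre hq
        hfin).thetaRegion3 j vQ :=
  fun _ _ => rfl

/-- Same `q`-pilot regions as `Real.settingPrVolM`. [folklore] -/
theorem qRegion_settingPrFramesM : ∀ (j : (thetaIndexOfInitial D).Label) (vQ : (thetaIndexOfInitial D).VQ),
    (settingPrFramesM D hlog M archPk archSub Ψ act Mmod region n lat sig split qData thetaBox qCentre hq hfin).qRegion
        j vQ =
      (settingPrVolM D hlog M archPk archSub Ψ act Mmod region n lat sig split qData thetaBox qCentre hq hfin).qRegion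
        j vQ :=
  fun _ _ => rfl

/-- **Same local `q`-volume** as `Real.settingPrVolM` (c312-6's hull-set locality). [claim: Mochizuki2012, status: disputed] -/
theorem qLocal_settingPrFramesM (j : (thetaIndexOfInitial D).Label) (vQ : (thetaIndexOfInitial D).VQ) :
    (settingPrFramesM D hlog M archPk archSub Ψ act Mmod region n lat sig split qData thetaBox qCentre hq hfin).qLocal
        j vQ =
      (settingPrVolM D hlog M archPk archSub Ψ act Mmod region n lat sig split qData thetaBox qCentre hq hfin).qLocal
        j vQ :=
  HullSetLocality.qLocal_eq
    (qRegion_settingPrFramesM D hlog M archPk archSub Ψ act Mmod region n lat sig split qData thetaBox qCentre hq hfin)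
    (logvol_agree_on_hul_settingPrFramesM D hlog M archPk archSub Ψ act Mmod region n lat sig split qData thetaBox
      qCentre hq hfin) j vQ

/-- **Same local `−|log(Θ)|`** as `Real.settingPrVolM`. [claim: Mochizuki2012, status: disputed] -/
theorem thetaLocal_settingPrFramesM (j : (thetaIndexOfInitial D).Label) (vQ : (thetaIndexOfInitial D).VQ) :
    (settingPrFramesM D hlog M archPk archSub Ψ act Mmod region n lat sig split qData thetaBox qCentre hq
        hfin).thetaLocal j vQ =
      (settingPrVolM D hlog M archPk archSub Ψ act Mmod region n lat sig split qData thetaBox qCentre hq hfin).thetaLocal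
        j vQ :=
  HullSetLocality.thetaLocal_eq
    (frame_settingPrFramesM D hlog M archPk archSub Ψ act Mmod region n lat sig split qData thetaBox qCentre hq hfin)
    (thetaRegion3_settingPrFramesM D hlog M archPk archSub Ψ act Mmod region n lat sig split qData thetaBox qCentre hq
      hfin)
    (logvol_agree_on_hul_settingPrFramesM D hlog M archPk archSub Ψ act Mmod region n lat sig split qData thetaBox
      qCentre hq hfin) j vQ

/-- **Same `−|log(Θ)|`** as `Real.settingPrVolM`. [claim: Mochizuki2012, status: disputed] -/
theorem negLogTheta_settingPrFramesM :
    (settingPrFramesM D hlog M archPk archSub Ψ act Mmod region n lat sig split qData thetaBox qCentre hq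
        hfin).negLogTheta =
      (settingPrVolM D hlog M archPk archSub Ψ act Mmod region n lat sig split qData thetaBox qCentre hq
        hfin).negLogTheta :=
  HullSetLocality.negLogTheta_eq
    (frame_settingPrFramesM D hlog M archPk archSub Ψ act Mmod region n lat sig split qData thetaBox qCentre hq hfin)
    (thetaRegion3_settingPrFramesM D hlog M archPk archSub Ψ act Mmod region n lat sig split qData thetaBox qCentre hq
      hfin)
    (logvol_agree_on_hul_settingPrFramesM D hlog M archPk archSub Ψ act Mmod region n lat sig split qData thetaBox
      qCentre hq hfin)

/-- **Same `−|log(q)|`** as `Real.settingPrVolM`. [claim: Mochizuki2012, status: disputed] -/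
theorem negLogQ_settingPrFramesM :
    (settingPrFramesM D hlog M archPk archSub Ψ act Mmod region n lat sig split qData thetaBox qCentre hq hfin).negLogQ =
      (settingPrVolM D hlog M archPk archSub Ψ act Mmod region n lat sig split qData thetaBox qCentre hq hfin).negLogQ :=
  HullSetLocality.negLogQ_eq
    (qRegion_settingPrFramesM D hlog M archPk archSub Ψ act Mmod region n lat sig split qData thetaBox qCentre hq hfin)
    (logvol_agree_on_hul_settingPrFramesM D hlog M archPk archSub Ψ act Mmod region n lat sig split qData thetaBox
      qCentre hq hfin)

/-- **CONTAINER-ROBUSTNESS AT THE M-LEVEL PRINT-NORMALISED SETTING.** The typed [IUTchIII] Cor. 3.12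
(`Cor312.Setting.Statement`, p. 174 l. 16–18) holds for the real log-shells `K_{v̲}` with packet-normalised FIELD-BOX
volumes iff it holds for the packet-normalised summandwise verbatim container `Real.settingPrVolM` — same binders; an
instance of c312-6's hull-set locality theorem. Neither side asserted. [claim: Mochizuki2012, status: disputed] -/
theorem statement_settingPrFramesM_iff :
    (settingPrFramesM D hlog M archPk archSub Ψ act Mmod region n lat sig split qData thetaBox qCentre hq
        hfin).Statement ↔
      (settingPrVolM D hlog M archPk archSub Ψ act Mmod region n lat sig split qData thetaBox qCentre hq
        hfin).Statement :=
  HullSetLocality.statement_iff_of_agree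
    (frame_settingPrFramesM D hlog M archPk archSub Ψ act Mmod region n lat sig split qData thetaBox qCentre hq hfin)
    (thetaRegion3_settingPrFramesM D hlog M archPk archSub Ψ act Mmod region n lat sig split qData thetaBox qCentre hq
      hfin)
    (qRegion_settingPrFramesM D hlog M archPk archSub Ψ act Mmod region n lat sig split qData thetaBox qCentre hq hfin)
    (logvol_agree_on_hul_settingPrFramesM D hlog M archPk archSub Ψ act Mmod region n lat sig split qData thetaBox
      qCentre hq hfin)

/-! ## §3. Provenance transfers -/

/-- **`IsSettingOf D` TRANSFERS between the two readings of `𝕄(−)` at the M level**: abc-iut-c312-8's provenance link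
(index skeleton `(l−1)/2`, places, finiteness of `𝕍^bad`, and the `q`-number clause `P.negLogQ = −|log(q)|(D)`) holds for
the field-box setting iff it holds for `Real.settingPrVolM` — the index clauses concern the common `thetaIndexOfInitial D`,
the number clause transfers by `negLogQ_settingPrFramesM`. [claim: Mochizuki2012, status: disputed] -/
theorem isSettingOf_settingPrFramesM_iff :
    IsSettingOf D (settingPrFramesM D hlog M archPk archSub Ψ act Mmod region n lat sig split qData thetaBox qCentre hq
      hfin) ↔
    IsSettingOf D (settingPrVolM D hlog M archPk archSub Ψ act Mmod region n lat sig split qData thetaBox qCentre hq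
      hfin) := by
  constructor
  · intro h
    exact ⟨h.lstar_eq, h.places, h.VFbad_finite, by
      rw [← negLogQ_settingPrFramesM D hlog M archPk archSub Ψ act Mmod region n lat sig split qData thetaBox qCentre hq
        hfin]
      exact h.negLogQ_eq⟩
  · intro h
    exact ⟨h.lstar_eq, h.places, h.VFbad_finite, by
      rw [negLogQ_settingPrFramesM D hlog M archPk archSub Ψ act Mmod region n lat sig split qData thetaBox qCentre hq
        hfin]
      exact h.negLogQ_eq⟩

/-- Hence, under provenance at either reading, the typed Cor. 3.12 at the field-box setting is the curve's inequality of
record exactly as at `Real.settingPrVolM`. Stated as the conjunction transfer. [claim: Mochizuki2012, status: disputed] -/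
theorem isSettingOf_and_statement_settingPrFramesM_iff :
    (IsSettingOf D (settingPrFramesM D hlog M archPk archSub Ψ act Mmod region n lat sig split qData thetaBox qCentre hq
        hfin) ∧
      (settingPrFramesM D hlog M archPk archSub Ψ act Mmod region n lat sig split qData thetaBox qCentre hq
        hfin).Statement) ↔
    (IsSettingOf D (settingPrVolM D hlog M archPk archSub Ψ act Mmod region n lat sig split qData thetaBox qCentre hq
        hfin) ∧
      (settingPrVolM D hlog M archPk archSub Ψ act Mmod region n lat sig split qData thetaBox qCentre hq
        hfin).Statement) :=
  and_congr
    (isSettingOf_settingPrFramesM_iff D hlog M archPk archSub Ψ act Mmod region n lat sig split qData thetaBox qCentre hq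
      hfin)
    (statement_settingPrFramesM_iff D hlog M archPk archSub Ψ act Mmod region n lat sig split qData thetaBox qCentre hq
      hfin)

open scoped Classical in
/-- **abc-iut-c312-8's M-level provenance, READ AT THE SUMMANDWISE SETTING.** `Cor312Prov.isSettingOf_settingOfFrameVolumes`
(`Cor312ProvenanceFrames`: the index clauses by construction, the `q`-number clause from the closed-form `qLocal_ofFrames`
MODULO its three printed clauses on the free binders — (hmarg) the weights have [IUTchIII] Rmk. 3.1.1 (ii)'s marginals,
(hbad)/(hgood) the `q`-centre's factorwise log-moduli are those of the `2l`-th root of the `q`-parameter) holds verbatim at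
`settingPrFramesM` (`settingPrFramesM_eq_settingOfFrameVolumes`), hence — by `isSettingOf_settingPrFramesM_iff` — at
`Real.settingPrVolM`: the `q`-side of a per-datum certificate over the summandwise route needs no second provenance file.
Binders verbatim those of c312-8's theorem. [claim: Mochizuki2012, status: disputed] -/
theorem isSettingOf_settingPrVolM_of_frames
    (jm : fieldOfModuli E) (hjm : (jm : F) = E.j)
    (gm : FinitePlace (fieldOfModuli E) → (thetaIndexOfInitial D).VQ)
    (Pr : FinitePlace (fieldOfModuli E) → ℝ) (hPr : ∀ w ∈ D.VbadMod, Pr w ≠ 0)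
    (π : ∀ (j : (thetaIndexOfInitial D).Label) (vQ : (thetaIndexOfInitial D).VQ),
      factorIdxM D hlog j vQ → FinitePlace (fieldOfModuli E))
    (hπ : ∀ j vQ i, gm (π j vQ i) = vQ)
    (hmarg : ∀ j vQ, ∀ w ∈ D.VbadMod, gm w = vQ →
      ∑ i ∈ Finset.univ.filter (fun i => π j vQ i = w), (frameVolumePiecesOfInitialDH D hlog).w j vQ i =
        Pr w / Module.finrank ℚ (fieldOfModuli E))
    (hbad : ∀ j vQ i, π j vQ i ∈ D.VbadMod →
      ((frameVolumePiecesOfInitialDH D hlog).vol j vQ i).mulLogvol (qCentre (qPilotObject qData) j vQ i) =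
        -(-(ord (fieldOfModuli E) (π j vQ i).maximalIdeal jm : ℝ) * logNorm (fieldOfModuli E) (π j vQ i).maximalIdeal) /
          (2 * (l : ℝ) * Pr (π j vQ i)))
    (hgood : ∀ j vQ i, π j vQ i ∉ D.VbadMod →
      ((frameVolumePiecesOfInitialDH D hlog).vol j vQ i).mulLogvol (qCentre (qPilotObject qData) j vQ i) = 0) :
    IsSettingOf D (settingPrVolM D hlog M archPk archSub Ψ act Mmod region n lat sig split qData thetaBox qCentre hq
      hfin) := by
  rw [← isSettingOf_settingPrFramesM_iff D hlog M archPk archSub Ψ act Mmod region n lat sig split qData thetaBox qCentre hq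
    hfin, settingPrFramesM_eq_settingOfFrameVolumes]
  exact isSettingOf_settingOfFrameVolumes D (S := situationPrFramesM D hlog M archPk archSub Ψ act Mmod region)
    (V := frameVolumePiecesOfInitialDH D hlog) lat sig split qData thetaBox qCentre hq _
    (realizes_situationPrFramesM D hlog M archPk archSub Ψ act Mmod region n) jm hjm gm Pr hPr π hπ hmarg hbad hgood

end Agreement

end Summit.ABC.IUTFork.Thm311.Real

end
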